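import Summits.NavierStokesRegularity.NavierStokesRegularity.Theorems.FilamentSkeletonRssDefectColumnGateVorticityAdjointIntegral
import Summits.NavierStokesRegularity.NavierStokesRegularity.Theorems.FilamentSkeletonRssKelvinGateCutoff

/-!
# Route `FilamentSkeletonRss` · ∀-crux `TransverseReduction1AR` (stmt-NavierStokesRegularity-23611) — NEGATIVE-side groundwork:
# the adjoint operator under a basin CUT-OFF, and the FLUX BALANCE of an exact profile

Helper file (theorems only), `--supports stmt-NavierStokesRegularity-23611 --as helper`; LEAD of 23611 / registrar of 23920, lane ns-filament-21221-p1 g14.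

* `vorticityAdjoint_smul` — Leibniz rule for the formal adjoint `𝒯_U^*` under a scalar cut-off `χ`:
  `𝒯_U^*(χΨ) = χ·𝒯_U^*Ψ − (Dχ[v] + Δχ)·Ψ − 2·DΨ[∇χ]`, `v = U + ½y − α e₃×y` (compare `lerayLin_smul`: the transport sign flips under adjunction).
* `flux_balance_of_exact_profile` — **(LD-b) in the kernel**: if `U ∈ C³` is solenoidal and solves the rotating-Leray profile equation `E_α(U) + ∇P = 0` (`P ∈ C²`),
  `Ψ ∈ C²` solves the adjoint equation `𝒯_U^*Ψ = 0` everywhere, and `χ ∈ C²` has compact support, then the FLUX of `Ω = curl U` through the cut-off layer vanishes: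
  `∫ ⟪(Dχ[v] + Δχ)·Ψ + 2·DΨ[∇χ], curl U⟫ = 0`.  With `Ψ` a committor-type adjoint mode and `χ` the indicator-like cut-off of tube j's basin this is
  «leak_j = feed_j» for an exact profile — the per-basin balance that B2′ contradicts at log precision (LD-a, not here).
HONEST FRAMING: calculus/bookkeeping on the NEGATIVE side of a HYPOTHETICAL filament-type rotating-self-similar blow-up route (MODEL rung); no item is proved or refuted;
23611/23920 OPEN; nothing here bears on Navier–Stokes regularity, which is NOT proved.
-/

set_option linter.dupNamespace false

noncomputable section

namespace Summit.NavierStokesRegularity.NavierStokesRegularity.Theorems.DefectColumnGate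

open scoped BigOperators Topology InnerProductSpace Laplacian ContDiff
open Set Function MeasureTheory
open Literature.Analysis.FluidPDE
open Summit.NavierStokesRegularity.NavierStokesRegularity.Theorems.KelvinGate

/-- **Leibniz rule for the formal adjoint under a scalar cut-off.**  For `χ ∈ C²(ℝ³; ℝ)`, `Ψ ∈ C²`, at every `y`:
`𝒯_U^*(χΨ)(y) = χ(y)·𝒯_U^*Ψ(y) − (Dχ(y)[U(y) + ½y − α e₃×y] + Δχ(y))·Ψ(y) − 2·DΨ(y)[∇χ(y)]`. -/
theorem vorticityAdjoint_smul (α : ℝ) (U Ψ : EuclideanSpace ℝ (Fin 3) → EuclideanSpace ℝ (Fin 3)) (χ : EuclideanSpace ℝ (Fin 3) → ℝ)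
    (hχ : ContDiff ℝ 2 χ) (hΨ : ContDiff ℝ 2 Ψ) (y : EuclideanSpace ℝ (Fin 3)) :
    -(α • (cross (EuclideanSpace.single 2 1) (χ y • Ψ y) - fderiv ℝ (fun z => χ z • Ψ z) y (cross (EuclideanSpace.single 2 1) y)))
        - (1/2:ℝ) • (χ y • Ψ y) - (1/2:ℝ) • fderiv ℝ (fun z => χ z • Ψ z) y y - (Δ (fun z => χ z • Ψ z)) y
        - fderiv ℝ (fun z => χ z • Ψ z) y (U y) - ContinuousLinearMap.adjoint (fderiv ℝ U y) (χ y • Ψ y)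
      = χ y • (-(α • (cross (EuclideanSpace.single 2 1) (Ψ y) - fderiv ℝ Ψ y (cross (EuclideanSpace.single 2 1) y))) - (1/2:ℝ) • Ψ y
          - (1/2:ℝ) • fderiv ℝ Ψ y y - (Δ Ψ) y - fderiv ℝ Ψ y (U y) - ContinuousLinearMap.adjoint (fderiv ℝ U y) (Ψ y))
        - (fderiv ℝ χ y (U y + (1/2:ℝ) • y - α • cross (EuclideanSpace.single 2 1) y) + (Δ χ) y) • Ψ y
        - (2:ℝ) • fderiv ℝ Ψ y (gradient χ y) := by
  have hχd : DifferentiableAt ℝ χ y := hχ.differentiable (by norm_num) y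
  have hΨd : DifferentiableAt ℝ Ψ y := hΨ.differentiable (by norm_num) y
  have hDap : ∀ h, fderiv ℝ (fun z => χ z • Ψ z) y h = χ y • fderiv ℝ Ψ y h + fderiv ℝ χ y h • Ψ y := fun h => by
    rw [fderiv_fun_smul hχd hΨd]; rfl
  have hL : (Δ (fun z => χ z • Ψ z)) y = χ y • (Δ Ψ) y + (2 : ℝ) • fderiv ℝ Ψ y (gradient χ y) + ((Δ χ) y) • Ψ y :=
    laplacian_smul_field hχ hΨ y
  rw [hDap, hDap, hDap, hL, cross_e3_smul, map_smul, map_sub, map_add, map_smul, map_smul]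
  module

/-- **FLUX BALANCE OF AN EXACT PROFILE ((LD-b) in the kernel).**  Let `U ∈ C³` be solenoidal with `E_α(U) + ∇P = 0` pointwise (`P ∈ C²`), let `Ψ ∈ C²` solve the adjoint
equation `𝒯_U^*Ψ = 0` pointwise, and let `χ ∈ C²` have compact support.  Then the flux of `curl U` through the cut-off layer against `Ψ` vanishes:
`∫ ⟪(Dχ[U + ½y − α e₃×y] + Δχ)·Ψ + 2·DΨ[∇χ], curl U⟫ = 0`. -/
theorem flux_balance_of_exact_profile (α : ℝ) {U Ψ : EuclideanSpace ℝ (Fin 3) → EuclideanSpace ℝ (Fin 3)} {P χ : EuclideanSpace ℝ (Fin 3) → ℝ}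
    (hU : ContDiff ℝ 3 U) (hdiv : VectorCalculus.IsDivFree U) (hP : ContDiff ℝ 2 P)
    (hprof : ∀ y, lerayOp α U y + gradient P y = 0)
    (hΨ : ContDiff ℝ 2 Ψ)
    (hadj : ∀ y, -(α • (cross (EuclideanSpace.single 2 1) (Ψ y) - fderiv ℝ Ψ y (cross (EuclideanSpace.single 2 1) y))) - (1/2:ℝ) • Ψ y
        - (1/2:ℝ) • fderiv ℝ Ψ y y - (Δ Ψ) y - fderiv ℝ Ψ y (U y) - ContinuousLinearMap.adjoint (fderiv ℝ U y) (Ψ y) = 0)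
    (hχ : ContDiff ℝ 2 χ) (hχc : HasCompactSupport χ) :
    ∫ y, ⟪(fderiv ℝ χ y (U y + (1/2:ℝ) • y - α • cross (EuclideanSpace.single 2 1) y) + (Δ χ) y) • Ψ y + (2:ℝ) • fderiv ℝ Ψ y (gradient χ y), curl U y⟫_ℝ = 0 := by
  -- the vorticity solves `𝒯_U Ω = 0`
  have hU2 : ContDiff ℝ 2 U := hU.of_le (by norm_num)
  have hΩ : ContDiff ℝ 2 (curl U) := contDiff_curl (n := 2) (by exact_mod_cast hU)
  have hvort : ∀ y, α • (cross (EuclideanSpace.single 2 1) (curl U y) - fderiv ℝ (curl U) y (cross (EuclideanSpace.single 2 1) y)) + curl U y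
      + (1/2:ℝ) • fderiv ℝ (curl U) y y - (Δ (curl U)) y + fderiv ℝ (curl U) y (U y) - fderiv ℝ U y (curl U y) = 0 := by
    intro y
    have h1 := curl_lerayOp_of_isDivFree α hU hdiv y
    have h2 : curl (lerayOp α U) y = 0 := by
      have e : lerayOp α U = fun z => -(gradient P z) := by
        funext z; have := hprof z; exact eq_neg_of_add_eq_zero_left this
      rw [e]
      have hg := curl_gradient_eq_zero_holds P hP y
      rw [curl_eq_curlCLM] at hg ⊢
      rw [fderiv_fun_neg, map_neg, hg, neg_zero]
    rw [h2, ← add_sub_assoc] at h1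
    exact h1.symm
  -- the test field `χΨ` is compactly supported and `C²`
  have hT : ContDiff ℝ 2 (fun z => χ z • Ψ z) := hχ.smul hΨ
  have hTc : HasCompactSupport (fun z => χ z • Ψ z) := hχc.smul_right
  -- integrated adjoint identity with test field `χΨ`: the left side vanishes
  have hI := integral_vorticity_adjoint α hU2 hΩ hT hTc hdiv
  have hL0 : ∫ y, ⟪χ y • Ψ y, α • (cross (EuclideanSpace.single 2 1) (curl U y) - fderiv ℝ (curl U) y (cross (EuclideanSpace.single 2 1) y)) + curl U y
      + (1/2:ℝ) • fderiv ℝ (curl U) y y - (Δ (curl U)) y + fderiv ℝ (curl U) y (U y) - fderiv ℝ U y (curl U y)⟫_ℝ = 0 := by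
    simp only [hvort, inner_zero_right, integral_zero]
  rw [hL0] at hI
  -- the right side: `𝒯^*(χΨ) = χ·𝒯^*Ψ − (Dχ[v] + Δχ)Ψ − 2DΨ[∇χ] = −(flux density)` since `𝒯^*Ψ = 0`
  have hR : ∀ y, ⟪-(α • (cross (EuclideanSpace.single 2 1) (χ y • Ψ y) - fderiv ℝ (fun z => χ z • Ψ z) y (cross (EuclideanSpace.single 2 1) y)))
        - (1/2:ℝ) • (χ y • Ψ y) - (1/2:ℝ) • fderiv ℝ (fun z => χ z • Ψ z) y y - (Δ (fun z => χ z • Ψ z)) y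
        - fderiv ℝ (fun z => χ z • Ψ z) y (U y) - ContinuousLinearMap.adjoint (fderiv ℝ U y) (χ y • Ψ y), curl U y⟫_ℝ
      = -⟪(fderiv ℝ χ y (U y + (1/2:ℝ) • y - α • cross (EuclideanSpace.single 2 1) y) + (Δ χ) y) • Ψ y + (2:ℝ) • fderiv ℝ Ψ y (gradient χ y), curl U y⟫_ℝ := by
    intro y
    rw [vorticityAdjoint_smul α U Ψ χ hχ hΨ y, hadj y, smul_zero, zero_sub, ← inner_neg_left]
    congr 1
    abel
  simp only [hR, integral_neg] at hI
  linarith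

/-- **FLUX IDENTITY FOR A FORCED PROFILE (the modulo-modes case of (LD-b)).**  If `U ∈ C³` is solenoidal and `E_α(U) + ∇P = F` pointwise (`P ∈ C²`, `F ∈ C²` — e.g.
`F = g·Zr + Σ_k B_k·D_k` for S3-mod's exact solution modulo the rate and accretion modes), `Ψ ∈ C²` solves `𝒯_U^*Ψ = 0`, and `χ ∈ C²` has compact support, then the
flux of `curl U` through the cut-off layer equals MINUS the pairing of the test field `χΨ` with `curl F`:
`∫ ⟪(Dχ[v] + Δχ)·Ψ + 2·DΨ[∇χ], curl U⟫ = −∫ ⟪χ·Ψ, curl F⟫` — for `F = Σ_k B_k D_k` the right side is `−Σ_k B_k ∫⟪χΨ, curl D_k⟫`: the near-diagonal system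
`M·B = −flux` of the LEAD's (LD-b) note. -/
theorem flux_identity_of_forced_profile (α : ℝ) {U Ψ F : EuclideanSpace ℝ (Fin 3) → EuclideanSpace ℝ (Fin 3)} {P χ : EuclideanSpace ℝ (Fin 3) → ℝ}
    (hU : ContDiff ℝ 3 U) (hdiv : VectorCalculus.IsDivFree U) (hP : ContDiff ℝ 2 P) (hF : ContDiff ℝ 2 F)
    (hprof : ∀ y, lerayOp α U y + gradient P y = F y)
    (hΨ : ContDiff ℝ 2 Ψ)
    (hadj : ∀ y, -(α • (cross (EuclideanSpace.single 2 1) (Ψ y) - fderiv ℝ Ψ y (cross (EuclideanSpace.single 2 1) y))) - (1/2:ℝ) • Ψ y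
        - (1/2:ℝ) • fderiv ℝ Ψ y y - (Δ Ψ) y - fderiv ℝ Ψ y (U y) - ContinuousLinearMap.adjoint (fderiv ℝ U y) (Ψ y) = 0)
    (hχ : ContDiff ℝ 2 χ) (hχc : HasCompactSupport χ) :
    ∫ y, ⟪(fderiv ℝ χ y (U y + (1/2:ℝ) • y - α • cross (EuclideanSpace.single 2 1) y) + (Δ χ) y) • Ψ y + (2:ℝ) • fderiv ℝ Ψ y (gradient χ y), curl U y⟫_ℝ
      = -∫ y, ⟪χ y • Ψ y, curl F y⟫_ℝ := by
  have hU2 : ContDiff ℝ 2 U := hU.of_le (by norm_num)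
  have hΩ : ContDiff ℝ 2 (curl U) := contDiff_curl (n := 2) (by exact_mod_cast hU)
  -- the vorticity solves `𝒯_U Ω = curl F`
  have hvort : ∀ y, α • (cross (EuclideanSpace.single 2 1) (curl U y) - fderiv ℝ (curl U) y (cross (EuclideanSpace.single 2 1) y)) + curl U y
      + (1/2:ℝ) • fderiv ℝ (curl U) y y - (Δ (curl U)) y + fderiv ℝ (curl U) y (U y) - fderiv ℝ U y (curl U y) = curl F y := by
    intro y
    have h1 := curl_lerayOp_of_isDivFree α hU hdiv y
    have h2 : curl (lerayOp α U) y = curl F y := by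
      have e : lerayOp α U = fun z => F z - gradient P z := by
        funext z; have := hprof z; exact eq_sub_of_add_eq this
      rw [e]
      have hg := curl_gradient_eq_zero_holds P hP y
      have hFd : DifferentiableAt ℝ F y := hF.differentiable (by norm_num) y
      have hGd : DifferentiableAt ℝ (gradient P) y := by
        have hD : Differentiable ℝ (fderiv ℝ P) := (hP.fderiv_right (m := 1) (by norm_num)).differentiable (by norm_num)
        have e : gradient P = fun z => (InnerProductSpace.toDual ℝ (EuclideanSpace ℝ (Fin 3))).symm (fderiv ℝ P z) := rfl
        rw [e]
        exact ((InnerProductSpace.toDual ℝ (EuclideanSpace ℝ (Fin 3))).symm.differentiable.comp hD) y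
      rw [curl_eq_curlCLM] at hg ⊢
      rw [curl_eq_curlCLM, fderiv_fun_sub hFd hGd, map_sub, hg, sub_zero]
    rw [h2, ← add_sub_assoc] at h1
    exact h1.symm
  have hT : ContDiff ℝ 2 (fun z => χ z • Ψ z) := hχ.smul hΨ
  have hTc : HasCompactSupport (fun z => χ z • Ψ z) := hχc.smul_right
  have hI := integral_vorticity_adjoint α hU2 hΩ hT hTc hdiv
  simp only [hvort] at hI
  have hR : ∀ y, ⟪-(α • (cross (EuclideanSpace.single 2 1) (χ y • Ψ y) - fderiv ℝ (fun z => χ z • Ψ z) y (cross (EuclideanSpace.single 2 1) y)))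
        - (1/2:ℝ) • (χ y • Ψ y) - (1/2:ℝ) • fderiv ℝ (fun z => χ z • Ψ z) y y - (Δ (fun z => χ z • Ψ z)) y
        - fderiv ℝ (fun z => χ z • Ψ z) y (U y) - ContinuousLinearMap.adjoint (fderiv ℝ U y) (χ y • Ψ y), curl U y⟫_ℝ
      = -⟪(fderiv ℝ χ y (U y + (1/2:ℝ) • y - α • cross (EuclideanSpace.single 2 1) y) + (Δ χ) y) • Ψ y + (2:ℝ) • fderiv ℝ Ψ y (gradient χ y), curl U y⟫_ℝ := by
    intro y
    rw [vorticityAdjoint_smul α U Ψ χ hχ hΨ y, hadj y, smul_zero, zero_sub, ← inner_neg_left]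
    congr 1
    abel
  simp only [hR, integral_neg] at hI
  linarith

/-! ## Localised form (appended by LEAD g14 on idea-crit-7 g6's remark): the adjoint equation is needed only on `tsupport χ` -/

/-- Outside the support of the cut-off the adjoint-cut-off expression vanishes identically, whatever `Ψ` does there. -/
theorem vorticityAdjoint_smul_eq_zero_of_notMem (α : ℝ) (U Ψ : EuclideanSpace ℝ (Fin 3) → EuclideanSpace ℝ (Fin 3)) (χ : EuclideanSpace ℝ (Fin 3) → ℝ)
    (hχ : ContDiff ℝ 2 χ) (hΨ : ContDiff ℝ 2 Ψ) {y : EuclideanSpace ℝ (Fin 3)} (hy : y ∉ tsupport χ) :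
    -(α • (cross (EuclideanSpace.single 2 1) (χ y • Ψ y) - fderiv ℝ (fun z => χ z • Ψ z) y (cross (EuclideanSpace.single 2 1) y)))
        - (1/2:ℝ) • (χ y • Ψ y) - (1/2:ℝ) • fderiv ℝ (fun z => χ z • Ψ z) y y - (Δ (fun z => χ z • Ψ z)) y
        - fderiv ℝ (fun z => χ z • Ψ z) y (U y) - ContinuousLinearMap.adjoint (fderiv ℝ U y) (χ y • Ψ y) = 0 := by
  have h0 : χ y = 0 := image_eq_zero_of_notMem_tsupport hy
  have h1 : fderiv ℝ χ y = 0 := by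
    have : y ∉ tsupport (fderiv ℝ χ) := fun h => hy (tsupport_fderiv_subset ℝ h)
    exact image_eq_zero_of_notMem_tsupport this
  have hg : gradient χ y = 0 := by rw [gradient, h1, map_zero]
  have h2 : (Δ χ) y = 0 := by
    have hev : χ =ᶠ[𝓝 y] fun _ => (0 : ℝ) := by
      have : (tsupport χ)ᶜ ∈ 𝓝 y := (isClosed_tsupport χ).isOpen_compl.mem_nhds hy
      filter_upwards [this] with z hz using image_eq_zero_of_notMem_tsupport hz
    have h := (InnerProductSpace.laplacian_congr_nhds hev).self_of_nhds
    rw [h, InnerProductSpace.laplacian_const]; rfl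
  rw [vorticityAdjoint_smul α U Ψ χ hχ hΨ y, h0, h1, h2, hg]
  simp

/-- **FLUX IDENTITY, localised adjoint hypothesis.**  As `flux_identity_of_forced_profile`, but the adjoint equation `𝒯_U^*Ψ = 0` is only required ON `tsupport χ` (an adjoint
mode defined on a basin neighbourhood, extended arbitrarily as a `C²` field, is enough). -/
theorem flux_identity_of_forced_profile_local (α : ℝ) {U Ψ F : EuclideanSpace ℝ (Fin 3) → EuclideanSpace ℝ (Fin 3)} {P χ : EuclideanSpace ℝ (Fin 3) → ℝ}
    (hU : ContDiff ℝ 3 U) (hdiv : VectorCalculus.IsDivFree U) (hP : ContDiff ℝ 2 P) (hF : ContDiff ℝ 2 F)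
    (hprof : ∀ y, lerayOp α U y + gradient P y = F y)
    (hΨ : ContDiff ℝ 2 Ψ) (hχ : ContDiff ℝ 2 χ) (hχc : HasCompactSupport χ)
    (hadj : ∀ y ∈ tsupport χ, -(α • (cross (EuclideanSpace.single 2 1) (Ψ y) - fderiv ℝ Ψ y (cross (EuclideanSpace.single 2 1) y))) - (1/2:ℝ) • Ψ y
        - (1/2:ℝ) • fderiv ℝ Ψ y y - (Δ Ψ) y - fderiv ℝ Ψ y (U y) - ContinuousLinearMap.adjoint (fderiv ℝ U y) (Ψ y) = 0) :
    ∫ y, ⟪(fderiv ℝ χ y (U y + (1/2:ℝ) • y - α • cross (EuclideanSpace.single 2 1) y) + (Δ χ) y) • Ψ y + (2:ℝ) • fderiv ℝ Ψ y (gradient χ y), curl U y⟫_ℝ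
      = -∫ y, ⟪χ y • Ψ y, curl F y⟫_ℝ := by
  have hU2 : ContDiff ℝ 2 U := hU.of_le (by norm_num)
  have hΩ : ContDiff ℝ 2 (curl U) := contDiff_curl (n := 2) (by exact_mod_cast hU)
  have hvort : ∀ y, α • (cross (EuclideanSpace.single 2 1) (curl U y) - fderiv ℝ (curl U) y (cross (EuclideanSpace.single 2 1) y)) + curl U y
      + (1/2:ℝ) • fderiv ℝ (curl U) y y - (Δ (curl U)) y + fderiv ℝ (curl U) y (U y) - fderiv ℝ U y (curl U y) = curl F y := by
    intro y
    have h1 := curl_lerayOp_of_isDivFree α hU hdiv y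
    have h2 : curl (lerayOp α U) y = curl F y := by
      have e : lerayOp α U = fun z => F z - gradient P z := by
        funext z; have := hprof z; exact eq_sub_of_add_eq this
      rw [e]
      have hg := curl_gradient_eq_zero_holds P hP y
      have hFd : DifferentiableAt ℝ F y := hF.differentiable (by norm_num) y
      have hGd : DifferentiableAt ℝ (gradient P) y := by
        have hD : Differentiable ℝ (fderiv ℝ P) := (hP.fderiv_right (m := 1) (by norm_num)).differentiable (by norm_num)
        have e : gradient P = fun z => (InnerProductSpace.toDual ℝ (EuclideanSpace ℝ (Fin 3))).symm (fderiv ℝ P z) := rfl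
        rw [e]
        exact ((InnerProductSpace.toDual ℝ (EuclideanSpace ℝ (Fin 3))).symm.differentiable.comp hD) y
      rw [curl_eq_curlCLM] at hg ⊢
      rw [curl_eq_curlCLM, fderiv_fun_sub hFd hGd, map_sub, hg, sub_zero]
    rw [h2, ← add_sub_assoc] at h1
    exact h1.symm
  have hT : ContDiff ℝ 2 (fun z => χ z • Ψ z) := hχ.smul hΨ
  have hTc : HasCompactSupport (fun z => χ z • Ψ z) := hχc.smul_right
  have hI := integral_vorticity_adjoint α hU2 hΩ hT hTc hdiv
  simp only [hvort] at hI
  -- pointwise: the adjoint-cut-off expression equals `−(layer density)` everywhere (on the support by `hadj`, off it both sides vanish)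
  have hR : ∀ y, ⟪-(α • (cross (EuclideanSpace.single 2 1) (χ y • Ψ y) - fderiv ℝ (fun z => χ z • Ψ z) y (cross (EuclideanSpace.single 2 1) y)))
        - (1/2:ℝ) • (χ y • Ψ y) - (1/2:ℝ) • fderiv ℝ (fun z => χ z • Ψ z) y y - (Δ (fun z => χ z • Ψ z)) y
        - fderiv ℝ (fun z => χ z • Ψ z) y (U y) - ContinuousLinearMap.adjoint (fderiv ℝ U y) (χ y • Ψ y), curl U y⟫_ℝ
      = -⟪(fderiv ℝ χ y (U y + (1/2:ℝ) • y - α • cross (EuclideanSpace.single 2 1) y) + (Δ χ) y) • Ψ y + (2:ℝ) • fderiv ℝ Ψ y (gradient χ y), curl U y⟫_ℝ := by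
    intro y
    by_cases hy : y ∈ tsupport χ
    · rw [vorticityAdjoint_smul α U Ψ χ hχ hΨ y, hadj y hy, smul_zero, zero_sub, ← inner_neg_left]
      congr 1
      abel
    · have h0 : fderiv ℝ χ y = 0 := by
        have : y ∉ tsupport (fderiv ℝ χ) := fun h => hy (tsupport_fderiv_subset ℝ h)
        exact image_eq_zero_of_notMem_tsupport this
      have hg : gradient χ y = 0 := by rw [gradient, h0, map_zero]
      have h2 : (Δ χ) y = 0 := by
        have hev : χ =ᶠ[𝓝 y] fun _ => (0 : ℝ) := by
          have : (tsupport χ)ᶜ ∈ 𝓝 y := (isClosed_tsupport χ).isOpen_compl.mem_nhds hy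
          filter_upwards [this] with z hz using image_eq_zero_of_notMem_tsupport hz
        have h := (InnerProductSpace.laplacian_congr_nhds hev).self_of_nhds
        rw [h, InnerProductSpace.laplacian_const]; rfl
      rw [vorticityAdjoint_smul_eq_zero_of_notMem α U Ψ χ hχ hΨ hy, h0, h2, hg]
      simp
  simp only [hR, integral_neg] at hI
  linarith

end Summit.NavierStokesRegularity.NavierStokesRegularity.Theorems.DefectColumnGate

end
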